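import Literature.MathematicalPhysics.QuantumLattice.BoundedWilsonFlowLift
import Literature.MathematicalPhysics.QuantumLattice.TorusWilsonFlowExistence
import HarnessLib

/-!
# The group law of the Wilson flow on a finite lattice (general gauge group)

Topic `Literature/MathematicalPhysics/QuantumLattice`; settles the debt "the group law" recorded under
"Deliberately NOT here" in `LatticeWilsonFlow.lean`, `BoundedWilsonFlowLift.lean` and
`TorusWilsonFlowExistence.lean`, for the tree's GENERAL matrix flow `matrixWilsonFlow H t V` of Lüscher's
equation (1.4) `V̇_t(e) = −π_𝔤(Ω_e(V_t)) V_t(e)` (any matrix group `H`, any dimension `d`, FINITE site type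
`R`, e.g. the discrete torus). The `SU(n)`-only version for the tree's other flow is
`QuantumFieldTheory.wilsonFlow_add` (`QuantumFieldTheory/WilsonFlow.lean`).

**Source.** M. Lüscher, *Properties and uses of the Wilson flow in lattice QCD*, JHEP 08 (2010) 071,
arXiv:1006.4518 [Luscher2010], eq. (1.4) and §1 p. 2: "The existence, uniqueness and smoothness of the
Wilson flow at all positive and negative times `t` is rigorously guaranteed on a finite lattice" — (1.4)
is an AUTONOMOUS first-order equation, so time-translates of flow lines are flow lines and uniqueness
gives the one-parameter group property `V_{s+t} = (V_t)_s`; this is what makes "the flow at time `t`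
applied to the configuration flowed to time `s`" meaningful (used e.g. when an estimate proved at one
flow time is transported along the flow, Lüscher §3).

## Contents (theorems only; everything stated is proved; no definitions)

* `IsWilsonFlowLine.shift` — if `Φ` is a flow line from `V`, then `u ↦ Φ (t + u)` is a flow line from
  `Φ t` (any site type).
* `matrixWilsonFlow_add` — **the group law** `matrixWilsonFlow H (s + t) V =
  matrixWilsonFlow H s (matrixWilsonFlow H t V)` on a finite lattice, UNCONDITIONALLY (when no flow line
  from `V` exists both sides are the junk value `V`); `matrixWilsonFlow_neg_matrixWilsonFlow` — time
  reversal `V ↦ V_t ↦ (V_t)_{−t} = V`; `matrixWilsonFlow_comm` — flows at two times commute.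
* `matrixWilsonFlow_eq_self_of_wilsonFlowField_eq_zero` — zeros of the vector field are stationary.
* Gauge-group level, for a faithful `ρ : G →* M_N(ℂ)` and a `G`-valued torus flow-line family `B`
  (`s ↦ ρ ∘ B s U` the matrix flow line of `ρ ∘ U`, the form quantified by the Yang–Mills route
  `FlowLineStateSpace`): `flowLine_add` (`B (s + t) U = B s (B t U)`), `flowLine_zero`, and the
  time-translation covariance of the flowed plaquette holonomies / energies
  (`plaquetteHolonomy_flowLine_add`).

Deliberately NOT here: that the matrix flow of `ρ ∘ U` stays in `ρ(G)` (so that `latticeWilsonFlow`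
itself satisfies the group law without a flow-line family as hypothesis), joint continuity in `(t, V)`,
gauge covariance.

## References

* M. Lüscher, JHEP 08 (2010) 071, arXiv:1006.4518, eq. (1.4), §1 p. 2. [Luscher2010]
-/

noncomputable section

open scoped Matrix.Norms.Frobenius
open Matrix

namespace Literature.MathematicalPhysics.QuantumLattice

/-! ### Time translation of flow lines -/

section MatrixLevel

variable {d : ℕ} {R : Type*} [AddGroup R] [One R] {N : ℕ}

/-- **Time-translates of flow lines are flow lines** ((1.4) is autonomous): if `Φ` solves (1.4) from
`V`, then `u ↦ Φ (t + u)` solves (1.4) from `Φ t`. [cite: Luscher2010, eq. (1.4)] -/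
theorem IsWilsonFlowLine.shift {H : Set (Matrix (Fin N) (Fin N) ℂ)} {V : MatrixLinkField d R N}
    {Φ : ℝ → MatrixLinkField d R N} (h : IsWilsonFlowLine H V Φ) (t : ℝ) :
    IsWilsonFlowLine H (Φ t) fun u => Φ (t + u) := by
  refine ⟨by simp only [add_zero], fun u e i j => ?_⟩
  exact (h.2 (t + u) e i j).comp_const_add t u

variable [Finite R]

/-- **The group law of the Wilson flow on a finite lattice**: `V_{s+t} = (V_t)_s`, i.e.
`matrixWilsonFlow H (s + t) V = matrixWilsonFlow H s (matrixWilsonFlow H t V)` — for every `H`, `V`,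
`s`, `t` (if a flow line from `V` exists: its time-translate is a flow line from `V_t`, and flow lines
on a finite lattice are unique; otherwise both sides are the junk value `V`).
[cite: Luscher2010, §1 p. 2 (after eq. (1.4))] -/
theorem matrixWilsonFlow_add (H : Set (Matrix (Fin N) (Fin N) ℂ)) (s t : ℝ) (V : MatrixLinkField d R N) :
    matrixWilsonFlow H (s + t) V = matrixWilsonFlow H s (matrixWilsonFlow H t V) := by
  by_cases h : ∃ Φ, IsWilsonFlowLine H V Φ
  · have hΦ := isWilsonFlowLine_matrixWilsonFlow h
    have hΨ := hΦ.shift t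
    have := hΨ.eq_matrixWilsonFlow s
    simpa only [add_comm s t] using this
  · have h0 : ∀ u : ℝ, matrixWilsonFlow H u V = V := fun u => by
      rw [matrixWilsonFlow, dif_neg h]
    rw [h0, h0, h0]

/-- **Time reversal**: flowing back undoes the flow, `(V_t)_{−t} = V`. [cite: Luscher2010, §1 p. 2 (after eq. (1.4))] -/
theorem matrixWilsonFlow_neg_matrixWilsonFlow (H : Set (Matrix (Fin N) (Fin N) ℂ)) (t : ℝ)
    (V : MatrixLinkField d R N) :
    matrixWilsonFlow H (-t) (matrixWilsonFlow H t V) = V := by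
  rw [← matrixWilsonFlow_add, neg_add_cancel, matrixWilsonFlow_zero]

/-- Flows at two times commute: `(V_t)_s = (V_s)_t`. [cite: Luscher2010, §1 p. 2 (after eq. (1.4))] -/
theorem matrixWilsonFlow_comm (H : Set (Matrix (Fin N) (Fin N) ℂ)) (s t : ℝ) (V : MatrixLinkField d R N) :
    matrixWilsonFlow H s (matrixWilsonFlow H t V) = matrixWilsonFlow H t (matrixWilsonFlow H s V) := by
  rw [← matrixWilsonFlow_add, ← matrixWilsonFlow_add, add_comm]

/-- **The flow at positive time is injective on link fields** (it has the two-sided inverse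
`matrixWilsonFlow H (−t)`). [cite: Luscher2010, §1 p. 2 (after eq. (1.4))] -/
theorem matrixWilsonFlow_injective (H : Set (Matrix (Fin N) (Fin N) ℂ)) (t : ℝ) :
    Function.Injective (matrixWilsonFlow H t : MatrixLinkField d R N → MatrixLinkField d R N) :=
  Function.LeftInverse.injective (g := matrixWilsonFlow H (-t))
    fun V => matrixWilsonFlow_neg_matrixWilsonFlow H t V

omit [Finite R] in
/-- A zero of the vector field of (1.4) carries the constant flow line. [cite: Luscher2010, eq. (1.4)] -/
theorem isWilsonFlowLine_const_of_wilsonFlowField_eq_zero {H : Set (Matrix (Fin N) (Fin N) ℂ)}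
    {V : MatrixLinkField d R N} (hV : wilsonFlowField H V = 0) :
    IsWilsonFlowLine H V fun _ => V := by
  refine ⟨rfl, fun t e i j => ?_⟩
  rw [hV]
  simpa using hasDerivAt_const t (V e i j)

/-- **Zeros of the vector field are stationary**: if `Z(V) V = 0` (e.g. `V` flat: every `Ω_e(V)` is
then a sum of `2(d−1)` copies of `1`, whose skew part vanishes), then `V_t = V` for all `t`.
[cite: Luscher2010, eq. (1.4)] -/
theorem matrixWilsonFlow_eq_self_of_wilsonFlowField_eq_zero {H : Set (Matrix (Fin N) (Fin N) ℂ)}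
    {V : MatrixLinkField d R N} (hV : wilsonFlowField H V = 0) (t : ℝ) :
    matrixWilsonFlow H t V = V :=
  ((isWilsonFlowLine_const_of_wilsonFlowField_eq_zero hV).eq_matrixWilsonFlow t).symm

end MatrixLevel

/-! ### Gauge-group level: `G`-valued torus flow-line families -/

section GroupLevel

variable {d : ℕ} {N : ℕ} {G : Type*} [Group G] (ρ : G →* Matrix (Fin N) (Fin N) ℂ)

/-- **Group law for a `G`-valued flow-line family.** If `ρ` is faithful and, for every configuration
`U` of the torus, `s ↦ ρ ∘ B s U` is the matrix Wilson flow line of `ρ ∘ U`, then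
`B (s + t) U = B s (B t U)`: the flow at time `s` of the configuration flowed to time `t` is the
configuration flowed to time `s + t` (time-translate + uniqueness on the finite torus + injectivity of
`ρ`). [cite: Luscher2010, §1 p. 2 (after eq. (1.4))] -/
theorem flowLine_add {L : ℕ} [NeZero L] (hρ : Function.Injective ρ)
    {B : ℝ → Literature.MathematicalPhysics.QuantumFieldTheory.GaugeConfig d L G →
      Literature.MathematicalPhysics.QuantumFieldTheory.GaugeConfig d L G}
    (hB : ∀ U, IsWilsonFlowLine (Set.range ρ) (fun e => ρ (U e)) fun s e => ρ (B s U e))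
    (s t : ℝ) (U : Literature.MathematicalPhysics.QuantumFieldTheory.GaugeConfig d L G) :
    B (s + t) U = B s (B t U) := by
  funext e
  apply hρ
  have h1 : (fun e => ρ (B (s + t) U e)) = matrixWilsonFlow (Set.range ρ) (s + t) fun e => ρ (U e) :=
    (hB U).eq_matrixWilsonFlow (s + t)
  have h2 : (fun e => ρ (B t U e)) = matrixWilsonFlow (Set.range ρ) t fun e => ρ (U e) :=
    (hB U).eq_matrixWilsonFlow t
  have h3 : (fun e => ρ (B s (B t U) e)) = matrixWilsonFlow (Set.range ρ) s fun e => ρ (B t U e) :=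
    (hB (B t U)).eq_matrixWilsonFlow s
  have h4 := congrFun h1 e
  have h5 := congrFun h3 e
  rw [h4, h5, h2, matrixWilsonFlow_add]

/-- At flow time `0` a `G`-valued flow-line family is the identity (faithful `ρ`). [cite: Luscher2010, eq. (1.4)] -/
theorem flowLine_zero {L : ℕ} (hρ : Function.Injective ρ)
    {B : ℝ → Literature.MathematicalPhysics.QuantumFieldTheory.GaugeConfig d L G →
      Literature.MathematicalPhysics.QuantumFieldTheory.GaugeConfig d L G}
    (hB : ∀ U, IsWilsonFlowLine (Set.range ρ) (fun e => ρ (U e)) fun s e => ρ (B s U e))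
    (U : Literature.MathematicalPhysics.QuantumFieldTheory.GaugeConfig d L G) : B 0 U = U := by
  funext e
  apply hρ
  exact congrFun (hB U).1 e

/-- The family flowed back: `B (−t) (B t U) = U` (faithful `ρ`, torus). [cite: Luscher2010, §1 p. 2 (after eq. (1.4))] -/
theorem flowLine_neg_flowLine {L : ℕ} [NeZero L] (hρ : Function.Injective ρ)
    {B : ℝ → Literature.MathematicalPhysics.QuantumFieldTheory.GaugeConfig d L G →
      Literature.MathematicalPhysics.QuantumFieldTheory.GaugeConfig d L G}
    (hB : ∀ U, IsWilsonFlowLine (Set.range ρ) (fun e => ρ (U e)) fun s e => ρ (B s U e))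
    (t : ℝ) (U : Literature.MathematicalPhysics.QuantumFieldTheory.GaugeConfig d L G) :
    B (-t) (B t U) = U := by
  rw [← flowLine_add ρ hρ hB, neg_add_cancel, flowLine_zero ρ hρ hB]

/-- **Time-translation covariance of flowed plaquette holonomies**: the holonomies of `B (s + t) U`
are those of `B s` applied to the flowed configuration `B t U`. [cite: Luscher2010, §1 p. 2 (after eq. (1.4))] -/
theorem plaquetteHolonomy_flowLine_add {L : ℕ} [NeZero L] (hρ : Function.Injective ρ)
    {B : ℝ → Literature.MathematicalPhysics.QuantumFieldTheory.GaugeConfig d L G →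
      Literature.MathematicalPhysics.QuantumFieldTheory.GaugeConfig d L G}
    (hB : ∀ U, IsWilsonFlowLine (Set.range ρ) (fun e => ρ (U e)) fun s e => ρ (B s U e))
    (s t : ℝ) (U : Literature.MathematicalPhysics.QuantumFieldTheory.GaugeConfig d L G)
    (x : Literature.MathematicalPhysics.QuantumFieldTheory.Site d L) (μ ν : Fin d) :
    Literature.MathematicalPhysics.QuantumFieldTheory.plaquetteHolonomy (B (s + t) U) x μ ν =
      Literature.MathematicalPhysics.QuantumFieldTheory.plaquetteHolonomy (B s (B t U)) x μ ν := by
  rw [flowLine_add ρ hρ hB]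

/-- **The flowed action density along a flow-line family is time-translation covariant**:
`flowedEnergy ρ (s + t) x U = flowedEnergy ρ s x (B t U)` for unitary faithful `ρ` (both sides are the
plaquette energy of `B (s+t) U = B s (B t U)`, by `flowedEnergy_eq_of_isWilsonFlowLine`).
[cite: Luscher2010, eq. (3.1) with §1 p. 2] -/
theorem flowedEnergy_add_eq {L : ℕ} [NeZero L] (hρ : Function.Injective ρ)
    (hu : ∀ g, ρ g ∈ Matrix.unitaryGroup (Fin N) ℂ)
    {B : ℝ → Literature.MathematicalPhysics.QuantumFieldTheory.GaugeConfig d L G →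
      Literature.MathematicalPhysics.QuantumFieldTheory.GaugeConfig d L G}
    (hB : ∀ U, IsWilsonFlowLine (Set.range ρ) (fun e => ρ (U e)) fun s e => ρ (B s U e))
    (s t : ℝ) (x : Literature.MathematicalPhysics.QuantumFieldTheory.Site d L)
    (U : Literature.MathematicalPhysics.QuantumFieldTheory.GaugeConfig d L G) :
    flowedEnergy ρ (s + t) x U = flowedEnergy ρ s x (B t U) := by
  rw [flowedEnergy_eq_of_isWilsonFlowLine ρ hu (hB U) (s + t) x,
    flowedEnergy_eq_of_isWilsonFlowLine ρ hu (hB (B t U)) s x, flowLine_add ρ hρ hB]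

end GroupLevel

end Literature.MathematicalPhysics.QuantumLattice
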